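/-
Copyright (c) 2026 the pub-hodgecm-mathlib formalisation cell (harness21).  Prover seat hodgecm-mathlib-F0P2-p11 (g2) (L1; LEAD F0P6-plan (g14) «(o1) KIND 1», memo
`CENSUS-K1-DealTable` brick (T4-α) part 3), Track B «K2-LIT» ∕ hLiu418 #184♮, ROAD Φ, G5-b: AT `n = 2` THE MIDDLE WEYL ELEMENT `w₀ = ι(1, g₀)` OF ★ p861327 IS
`blkD (1, w_Δ⁽¹⁾)`, THE CORNER COORDINATE OF `blkD (1, y)` IS `single 1 1`, AND `N_Δ` ELEMENTS ARE DETERMINED BY THEIR CORNER COORDINATE.  THEOREMS ONLY.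
-/
import Summits.HodgeConjecture.HodgeConjecture.Theorems.K2LiuBlockDiagUnipotentChart     -- ★ p862538 (T4-α) part 2 (+ ★ `blkD`, ★ `SiegelDoubledUnipotent`)
import HarnessLib

/-!
# Crux `HLiu418`, KIND 1, brick (T4-α) part 3 (`n = 2`): `ι(1, g₀) = blkD (1, w_Δ⁽¹⁾)`, the corner coordinate of the chart, uniqueness of unipotents by their corner

Cell `hodgecm-mathlib`, crux item hLiu418 = `stmt-HodgeConjecture-24832` (helper lane, count-neutral); squad K2 ∕ K2Liu, LEAD F0P6-plan (g14); prover F0P2-p11 (g2).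
THEOREMS ONLY (no `def`, no `instance`, no notation, no named-fact hypothesis, no `sorry`).

SETTING of ★ p861153 ∕ p861327 ((R1-α)(b)): `n = 2`, the reflection `g₀ = diag(1 − 2·[e k = 1])` (`hg₀`), `w₀ = ι(1, g₀)`; and Kudla's see-saw chart ★ `blkD` for `V = V₁ ⊕ V₂`
with `N₁ = N₂ = M = 1` (`e : Fin (1+1) × Fin 1 ≃ Fin 2`, `eA, eB : Fin 1 × Fin 1 ≃ Fin n₁, Fin n₂`), under the CORNER HYPOTHESIS `he : e (1, 0) = 1` (the corner index `1 : Fin 2`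
of the rank-one files is the `V₂`-summand; the other enumeration is the `inl` twin, successor's one-line variant).
* §1 **`eq_of_mem_unipDelta_of_toBlocks₁₂_eq`** (generic datum) — two elements of `N_Δ(𝔸)` with the same corner coordinate `(blk ·)₁₂` are equal (★ `mem_unipDelta_iff_conj`,
  ★ `eq_of_conjE_eq`, ★ `eq_of_blk_eq`): the device identifying ★ p861153's corner line `n₂ t` with `blkD (1, n⁽¹⁾ t)`.
* §2 (`n = 2`, `he`) `idxSplit_one`, `idxSplit_zero` — `σ 1 = inr (eB (0,0))`, `σ 0 = inl (eA (0,0))`; `eq_eB`, `eq_eA` — `Fin n₂`, `Fin n₁` are singletons.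
* §3 **`blk_blkD_one_inr_toBlocks₁₂_two`** — `(blk (blkD (1, y)))₁₂ = single 1 1 (X(y) b b)`, `b = eB (0,0)`: the chart's unipotents are CORNER-SUPPORTED at index `1`.
* §4 **`iotaGG_one_eq_blkD_weylDelta`** — `ι(1, g₀) = blkD (1, w_Δ⁽¹⁾)`: the middle Weyl element of the rank-one files IS the image of the big-cell Weyl element of the doubled LINE
  (★ `blk_iotaGG_eq` + ★ `coe_rationalPairToAdelic` + `hg₀` against ★ `blk_weylDelta` through ★ `blk_blkD_toBlocks··`).
⇒ (T4-β) (successor): `f(w₀ · n₂ t · g) = F_g(w_Δ⁽¹⁾ · n⁽¹⁾ t)` with `F_g := f (blkD (1, ·) · g) ∈ I_Δ⁽¹⁾(s + ½)` (★ p862495), `ψ_S(n₂ t) = ψ⁽¹⁾_{S₂₂}(n⁽¹⁾ t)` (★ p862538), and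
the corner-line integral becomes `whittakerDelta⁽¹⁾` after Haar transport `t ↦ n⁽¹⁾ t`.
HONEST LABEL.  Count-neutral helper; `HC_CM` is proved only modulo the 7 printed citations (2 remaining named inputs: hLiu418 = `stmt-HodgeConjecture-24832`,
h413 = `stmt-HodgeConjecture-24833`) until rung 0 closes.

## References
* [Kudla1994] S. Kudla, Israel J. Math. 87 (1994), §2, Thm. 3.1.
* [KudlaRallis1994] S. Kudla, S. Rallis, Ann. of Math. 140 (1994), §2 (2.10)–(2.12).
* [GelbartPiatetskishapiroRallis1987] S. Gelbart, I. Piatetski-Shapiro, S. Rallis, LNM 1254 (1987), Part A §1–§2.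
* [MoeglinWaldspurger1995] C. Mœglin, J.-L. Waldspurger, CUP (1995), I.2.1, II.1.7.
-/

set_option autoImplicit false
set_option linter.dupNamespace false -- the mandated namespace repeats `HodgeConjecture.HodgeConjecture`

noncomputable section

open scoped Matrix
open NumberField IsDedekindDomain
open Literature.NumberTheory.Automorphic Literature.NumberTheory.Automorphic.UnitaryGroup Literature.NumberTheory.GaloisRepresentations
open Literature.NumberTheory.GelbartRogawski1991 Literature.NumberTheory.GelbartRogawski1991.GRConstruction
open Literature.NumberTheory.K2Lit.SiegelDoubled
open UnitaryDualPair

namespace Summit.HodgeConjecture.HodgeConjecture.Cruxes.HLiu418.K2LiuCornerLineChartTwo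

open K2LiuSiegelUnipotentFourierDefs K2LiuBlockDiagUnipotentChart

variable (L : Type) [Field L] [NumberField L] [IsCMField L]

/-! ## §1 Unipotents are determined by their corner coordinate (generic datum) -/

section Unique

variable {N M n : ℕ} (e : Fin N × Fin M ≃ Fin n)
  (dV : Fin N → L) (hdV : ∀ i, IsCMField.complexConj L (dV i) = dV i)
  (dW : Fin M → L) (hdW : ∀ i, IsCMField.complexConj L (dW i) = dW i)

/-- **two elements of `N_Δ(𝔸)` with the same corner coordinate are equal** (`E₁ · blk u · E₂ = (1 X(u); 0 1)` ★ `mem_unipDelta_iff_conj`, ★ `eq_of_conjE_eq`, ★ `eq_of_blk_eq`).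
[cite: Kudla1994, §2] [cite: MoeglinWaldspurger1995, I.2.1] -/
theorem eq_of_mem_unipDelta_of_toBlocks₁₂_eq {u u' : HA L e dV hdV dW hdW} (hu : u ∈ unipDelta L e dV hdV dW hdW) (hu' : u' ∈ unipDelta L e dV hdV dW hdW)
    (h : (blk L e dV hdV dW hdW u).toBlocks₁₂ = (blk L e dV hdV dW hdW u').toBlocks₁₂) : u = u' := by
  refine eq_of_blk_eq L e dV hdV dW hdW (eq_of_conjE_eq ?_)
  rw [(mem_unipDelta_iff_conj L e dV hdV dW hdW u).1 hu, (mem_unipDelta_iff_conj L e dV hdV dW hdW u').1 hu', h]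

end Unique

/-! ## §2 `n = 2`: the see-saw enumeration under the corner hypothesis -/

variable {n₁ n₂ : ℕ} (e : Fin (1 + 1) × Fin 1 ≃ Fin 2) (eA : Fin 1 × Fin 1 ≃ Fin n₁) (eB : Fin 1 × Fin 1 ≃ Fin n₂)
  (dA : Fin 1 → L) (hdA : ∀ i, IsCMField.complexConj L (dA i) = dA i)
  (dB : Fin 1 → L) (hdB : ∀ i, IsCMField.complexConj L (dB i) = dB i)
  (dV : Fin (1 + 1) → L) (hdV : ∀ i, IsCMField.complexConj L (dV i) = dV i)
  (hVA : ∀ i, dV (Fin.castAdd 1 i) = dA i) (hVB : ∀ j, dV (Fin.natAdd 1 j) = dB j)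
  (dW : Fin 1 → L) (hdW : ∀ i, IsCMField.complexConj L (dW i) = dW i)

omit [NumberField L] [IsCMField L] in
include eB in
/-- `Fin n₂` is a singleton: every `m` is `eB (0, 0)`. [folklore] -/
theorem eq_eB (m : Fin n₂) : m = eB (0, 0) := by
  rw [← eB.apply_symm_apply m]
  exact congrArg eB (Subsingleton.elim _ _)

omit [NumberField L] [IsCMField L] in
include eA in
/-- `Fin n₁` is a singleton: every `m` is `eA (0, 0)`. [folklore] -/
theorem eq_eA (m : Fin n₁) : m = eA (0, 0) := by
  rw [← eA.apply_symm_apply m]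
  exact congrArg eA (Subsingleton.elim _ _)

omit [NumberField L] [IsCMField L] in
include e in
/-- under the corner hypothesis the other basis vector sits at index `0`. [folklore] -/
theorem apply_zero_of_apply_one (he : e (1, 0) = 1) : e (0, 0) = 0 := by
  have hne : e (0, 0) ≠ 1 := fun h => by
    have := e.injective (h.trans he.symm)
    simp at this
  generalize e (0, 0) = i at hne ⊢
  fin_cases i
  · rfl
  · exact absurd rfl hne

omit [NumberField L] [IsCMField L] in
/-- **`σ 1 = inr b`**, `b = eB (0,0)`: the corner index `1 : Fin 2` is the `V₂`-summand (★ `eV_symm_idxSplit_symm_inr`). [cite: Kudla1994, §2] -/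
theorem idxSplit_one (he : e (1, 0) = 1) : idxSplit e eA eB 1 = Sum.inr (eB (0, 0)) := by
  have h := eV_symm_idxSplit_symm_inr e eA eB (eB (0, 0))
  rw [Equiv.symm_apply_apply] at h
  have h' : (idxSplit e eA eB).symm (Sum.inr (eB (0, 0))) = 1 := by
    rw [← he, ← e.apply_symm_apply ((idxSplit e eA eB).symm (Sum.inr (eB (0, 0)))), h]
    rfl
  rw [← h', Equiv.apply_symm_apply]

omit [NumberField L] [IsCMField L] in
/-- **`σ 0 = inl a`**, `a = eA (0,0)` (★ `eV_symm_idxSplit_symm_inl`). [cite: Kudla1994, §2] -/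
theorem idxSplit_zero (he : e (1, 0) = 1) : idxSplit e eA eB 0 = Sum.inl (eA (0, 0)) := by
  have h := eV_symm_idxSplit_symm_inl e eA eB (eA (0, 0))
  rw [Equiv.symm_apply_apply] at h
  have h' : (idxSplit e eA eB).symm (Sum.inl (eA (0, 0))) = 0 := by
    rw [← apply_zero_of_apply_one e he, ← e.apply_symm_apply ((idxSplit e eA eB).symm (Sum.inl (eA (0, 0)))), h]
    rfl
  rw [← h', Equiv.apply_symm_apply]

omit [NumberField L] [IsCMField L] in
/-- the see-saw re-enumeration of a block sum at `n = 2`, entrywise: `σ⁻¹(A ⊕ D)` is `diag(A a a, D b b)` plus nothing off the diagonal.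
[cite: Kudla1994, §2] -/
theorem reindex_symm_fromBlocks_two {R : Type*} [Zero R] (he : e (1, 0) = 1) (A : Matrix (Fin n₁) (Fin n₁) R) (D : Matrix (Fin n₂) (Fin n₂) R) :
    Matrix.reindex (idxSplit e eA eB).symm (idxSplit e eA eB).symm (Matrix.fromBlocks A 0 0 D) =
      !![A (eA (0, 0)) (eA (0, 0)), 0; 0, D (eB (0, 0)) (eB (0, 0))] := by
  ext i j
  simp only [Matrix.reindex_apply, Matrix.submatrix_apply, Equiv.symm_symm]
  fin_cases i <;> fin_cases j <;>
    simp [idxSplit_one e eA eB he, idxSplit_zero e eA eB he, Matrix.fromBlocks_apply₁₁, Matrix.fromBlocks_apply₁₂, Matrix.fromBlocks_apply₂₁,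
      Matrix.fromBlocks_apply₂₂]

/-! ## §3 The corner coordinate of the chart at `n = 2` -/

/-- **`(blk (blkD (1, y)))₁₂ = single 1 1 (X(y) b b)`**, `b = eB (0,0)`: the chart's elements are corner-supported at index `1` (★ p862538 `blk_blkD_one_inr_toBlocks₁₂` + §2).
[cite: KudlaRallis1994, §2 (2.10)–(2.12)] [cite: Kudla1994, §2] -/
theorem blk_blkD_one_inr_toBlocks₁₂_two (he : e (1, 0) = 1) (y : HA L eB dB hdB dW hdW) :
    (blk L e dV hdV dW hdW (blkD L e eA eB dA hdA dB hdB dV hdV hVA hVB dW hdW (1, y))).toBlocks₁₂ =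
      Matrix.single (1 : Fin 2) (1 : Fin 2) ((blk L eB dB hdB dW hdW y).toBlocks₁₂ (eB (0, 0)) (eB (0, 0))) := by
  rw [blk_blkD_one_inr_toBlocks₁₂, reindex_symm_fromBlocks_two e eA eB he]
  ext i j
  fin_cases i <;> fin_cases j <;> simp [Matrix.single]

/-! ## §4 The middle Weyl element of the rank-one files is `blkD (1, w_Δ⁽¹⁾)` -/

/-- **`ι(1, g₀) = blkD (1, w_Δ⁽¹⁾)`** at `n = 2` under the corner hypothesis: `blk ι(1, g₀) = diag(1, diag(1, −1))` (★ `blk_iotaGG_eq`, ★ `coe_rationalPairToAdelic`, `hg₀`) and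
`blk (blkD (1, w_Δ⁽¹⁾)) = diag(1, σ⁻¹(1 ⊕ (−1)))` (★ `blk_blkD_toBlocks··`, ★ `blk_weylDelta`), equal by §2; conclude by ★ `eq_of_blk_eq`.
[cite: GelbartPiatetskishapiroRallis1987, Part A §1–§2] [cite: KudlaRallis1994, §2 (2.10)–(2.12)] [cite: Kudla1994, §2] -/
theorem iotaGG_one_eq_blkD_weylDelta (he : e (1, 0) = 1)
    {g₀ : UnitaryGroup.rationalPair (Fp L) L (IsCMField.complexConj L) (1 + 1) 1 (Matrix.diagonal dV) (Matrix.diagonal dW)}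
    (hg₀ : ((g₀ : GL (Fin (1 + 1) × Fin 1) L) : Matrix (Fin (1 + 1) × Fin 1) (Fin (1 + 1) × Fin 1) L) =
      Matrix.diagonal (fun k => 1 - 2 * (![0, 1] : Fin 2 → L) (e k))) :
    iotaGG L e dV hdV dW hdW (1, UnitaryGroup.rationalPairToAdelic (Fp L) L (IsCMField.complexConj L) (1 + 1) 1 (Matrix.diagonal dV) (Matrix.diagonal dW) g₀) =
      blkD L e eA eB dA hdA dB hdB dV hdV hVA hVB dW hdW (1, weylDelta L eB dB hdB dW hdW) := by
  refine eq_of_blk_eq L e dV hdV dW hdW ?_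
  have h1 := blk_one_toBlocks eA dA hdA dW hdW
  have hw : (blk L eB dB hdB dW hdW (weylDelta L eB dB hdB dW hdW)).toBlocks₁₁ = 1 ∧ (blk L eB dB hdB dW hdW (weylDelta L eB dB hdB dW hdW)).toBlocks₁₂ = 0 ∧
      (blk L eB dB hdB dW hdW (weylDelta L eB dB hdB dW hdW)).toBlocks₂₁ = 0 ∧ (blk L eB dB hdB dW hdW (weylDelta L eB dB hdB dW hdW)).toBlocks₂₂ = -1 := by
    rw [blk_weylDelta, Matrix.toBlocks_fromBlocks₁₁, Matrix.toBlocks_fromBlocks₁₂, Matrix.toBlocks_fromBlocks₂₁, Matrix.toBlocks_fromBlocks₂₂]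
    exact ⟨rfl, rfl, rfl, rfl⟩
  -- the right-hand side, block by block
  rw [← Matrix.fromBlocks_toBlocks (blk L e dV hdV dW hdW (blkD L e eA eB dA hdA dB hdB dV hdV hVA hVB dW hdW (1, weylDelta L eB dB hdB dW hdW))),
    blk_blkD_toBlocks₁₁, blk_blkD_toBlocks₁₂, blk_blkD_toBlocks₂₁, blk_blkD_toBlocks₂₂, h1.1, h1.2.1, h1.2.2.1, h1.2.2.2, hw.1, hw.2.1, hw.2.2.1, hw.2.2.2,
    blk_iotaGG_eq]
  -- both sides entrywise
  simp only [reindex_symm_fromBlocks_two e eA eB he, OneMemClass.coe_one, Units.val_one, Matrix.reindex_apply, Matrix.submatrix_one_equiv,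
    coe_rationalPairToAdelic, hg₀]
  have h12 : (1 : AdeleRing (𝓞 L) L) - 2 = -1 := by norm_num
  ext i j
  rcases i with i | i <;> rcases j with j | j <;> fin_cases i <;> fin_cases j <;>
    simp [Matrix.fromBlocks_apply₁₁, Matrix.fromBlocks_apply₁₂, Matrix.fromBlocks_apply₂₁, Matrix.fromBlocks_apply₂₂, Matrix.neg_apply, map_ofNat, h12]

end Summit.HodgeConjecture.HodgeConjecture.Cruxes.HLiu418.K2LiuCornerLineChartTwo

end
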